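import Literature.AnabelianGeometry.EtaleTheta.BiKummerThm44SubModelWeakRootsReading
import Literature.AnabelianGeometry.EtaleTheta.BiKummerThm44SubFrdI
import Literature.AnabelianGeometry.EtaleTheta.Discharge.Sec3RatFnMonoidOn
import Literature.AlgebraicGeometry.Frobenioids.QuasiTemperoidConnectedPart
import Literature.AnabelianGeometry.SemiGraphs.CosetCategoriesSlimTempered

/-!
# [EtTh] Theorem 4.4 (i)(ii)(iii) + `N`-th roots at the GENUINE connected base over the WEAK vocabulary: binder census
# {Rmk 3.7.2 (`Remark372 D₀ / D₀'`), `hBmon₁ / hBmon₂`} ↦ {`hBinj₁ / hBinj₂`}; at the roots reading NO named fact remains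

S. Mochizuki, *The étale theta function …*, Publ. RIMS **45** (2009) [MochizukiEtTh2009], §4, Thm 4.4 (i)–(iii), PDF
p.94, proof p.95.  abc-iut cell, layer L2, plan/L2/SUBDAG-EtTh-Thm44.md (custodian lineage abc-iut-w5-d179), cone nodes
`EtTh:Thm4.4(i)/(ii)/(iii)`.  PROOF-ONLY companion (seat abc-iut-w6-d037, gen 2; 0 `def`s); nothing landed is edited or
restated.

The weak-vocabulary twin of abc-iut-w5-d179's `BiKummerThm44SubModelConnectedBinj.lean` (binder census at
`treeMonoidVocab`), composed from this seat's weak chain (`BiKummerThm44SubModelPairsWeak` — T44-L04 without the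
perf-factorial binder —, `BiKummerThm44SubModelWeak`, `BiKummerThm44SubModelWeakRootsReading`) and the vocabulary-generic
inputs used there: «`B^temp(Π)⁰` is of FSM-type» = [FrdII] Ex 1.3 (i) (`QuasiTemperoid.BTempConnected.connectedPart_isOfFSMType`),
«`B^temp(Π^tp_X)⁰` is slim» = [SemiAnbd] Rmk 3.4.1 / Ex 3.10 (`TemperedArithmeticGroup.isSlim_connectedPart`), `hBmon_i`
from `hBinj_i` (abc-iut-L2-t3's `TemperedFrobenioid.isMonoidOn_ratFnFunctor hBinj hFSM`), «`C_i` Frobenioid» from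
`hBinj_i` (`isFrobenioid_of_structural`), T44-L09 / T44-L09c by abc-iut-w5-d013 ([SemiAnbd] Prop 3.2), T44-L15b at the
roots reading by abc-iut-w4-d044.  Realified data `T_i : RealifiedDivisorMonoids treeMonoidVocabWeak` — the vocabulary of
the coverings `Ÿ`, `Z_∞` where [FrdI] Def 2.4 (i)(d) fails (F-L2d2-1).
* §0 (settings over `treeCatVocab`): `preservesFrobeniusStructure_of_isOfFSMType_treeVocabWeak` (T44-L03 ⇐ {`hBmon`,
  FSM-type}), `thm44_iii_of_isOfFSMType_treeVocabWeak` ((iii) ⇐ {`hBmon`, FSM-type, T44-L15b});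
* §1 (`mkOfModelCanonical`, arbitrary bases): `preservesBaseFrobeniusPairs_mkOfModelCanonical_of_isOfFSMType_treeVocabWeak`
  (T44-L04 ⇐ {`hBmon`, FSM-type, slim}), `thm44_ii_mkOfModelCanonical_of_isFrobenioid_treeVocabWeak` ((ii) ⇐ {«`C_i`
  Frobenioid», T44-L03} for any proofs), `preservesNthRoots_mkOfModelCanonical_of_isOfFSMType_treeVocabWeak` (T44-L14 ⇐
  {`hBmon`, FSM-type, slim, T44-L09c, T44-L15b});
* §2 (`mkOfConnectedTemperoid`): **`thm44_mkOfConnectedTemperoid_of_hBinj_treeVocabWeak` : (i) ∧ (ii) ∧ (iii) ∧ (`N`-th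
  roots) ⇐ {`hBinj₁`, `hBinj₂`, T44-L15b} ONLY** (and the primed form with the ψ-slot proofs themselves from `hBinj`);
* §3 (`mkOfConnectedTemperoid` with `NH :=` the ROOTS READING, HONEST LABEL as in abc-iut-w4-d044's file — weaker than
  [FrdII] Def 2.2 (ii)(c)): **`thm44_mkOfConnectedTemperoid_rootsReading_of_hBinj_treeVocabWeak` : (i) ∧ (ii) ∧ (iii) ∧
  (`N`-th roots) ⇐ {`hBinj₁`, `hBinj₂`} ONLY** — `hBinj_i` = the pull-backs of the Def 3.6 (i) datum `B₀^Λ` are injective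
  (Def 3.3 (iii), a property of the INPUT data); no named fact of plan/FACT-LIST and no perf-factorial binder is an input
  of the three cone nodes at the genuine base over the weak vocabulary at that reading.
Statements name the vocabulary (`(V := treeMonoidVocabWeak)`) where they would otherwise read as their strong twins.
HONEST FRAMING: refereed pre-IUT material ([FrdI]/[FrdII] 2008, [EtTh] 2009, [SemiAnbd] 2006); every theorem is an
implication for data so parametrised; nothing here asserts that such data exist for an actual curve or bears on the
disputed [IUTchIII] Cor. 3.12; typed ≠ proved — here PROVED (kernel compositions).
-/

noncomputable section

namespace Literature.AnabelianGeometry.EtaleTheta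

open CategoryTheory Opposite Function Literature.AlgebraicGeometry.Frobenioids Literature.AnabelianGeometry.SemiGraphs

namespace BiKummerSetting

universe u₀ v₀ u v w

/-! ### §0 Settings over the weak realified data and `treeCatVocab`: T44-L03, (iii) from {`hBmon`, FSM-type} -/

section TreeVocabWeak

variable {K : Type u₀} [Field K] {K' : Type u₀} [Field K'] {D₀ : Type u₀} [Category.{v₀} D₀]
  {X₁ : SemiGraphs.TemperedArithmeticGroup.{u₀} K} {X₂ : SemiGraphs.TemperedArithmeticGroup.{u₀} K'}
  {D₀' : Type u₀} [Category.{v₀} D₀']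
  {T₁ : RealifiedDivisorMonoids (D₀ := D₀) treeMonoidVocabWeak.{w}}
  {T₂ : RealifiedDivisorMonoids (D₀ := D₀') treeMonoidVocabWeak.{w}}
  {D₁ D₂ : Type u} [Category.{v} D₁] [Category.{v} D₂]
  {IsRational₁ IsStrictlyRational₁ : (D₁ᵒᵖ ⥤ CommMonCat.{w}) → Prop}
  {IsRational₂ IsStrictlyRational₂ : (D₂ᵒᵖ ⥤ CommMonCat.{w}) → Prop}
  {S₁ : BiKummerSetting X₁ T₁ D₁ (treeCatVocab D₁ IsRational₁ IsStrictlyRational₁)}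
  {S₂ : BiKummerSetting X₂ T₂ D₂ (treeCatVocab D₂ IsRational₂ IsStrictlyRational₂)}

/-- **T44-L03 from {`hBmon₁ / hBmon₂`, «`D_i` of FSM-type»}, WEAK vocabulary**: `Ψ` preserves Frobenius degrees,
isometries, morphisms of Frobenius type and pull-backs ([FrdI] Thm 3.4 (iii), `preservesFrobeniusStructure_of_thm34`).
[cite: MochizukiEtTh2009, Thm 4.4 p.95] -/
theorem Thm44Hyp.preservesFrobeniusStructure_of_isOfFSMType_treeVocabWeak (h : Thm44Hyp S₁ S₂)
    (hBmon₁ : IsMonoidOn S₁.tf.ratFnFunctor) (hBmon₂ : IsMonoidOn S₂.tf.ratFnFunctor)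
    (hD₁ : IsOfFSMType D₁) (hD₂ : IsOfFSMType D₂) : Thm44Hyp.PreservesFrobeniusStructure (V := treeMonoidVocabWeak.{w}) h :=
  h.preservesFrobeniusStructure_of_thm34 (S₁.tf.isFrobenioid_treeCatVocab_of_isMonoidOn hBmon₁)
    (S₂.tf.isFrobenioid_treeCatVocab_of_isMonoidOn hBmon₂) hD₁ hD₂ h.isNonDilatingOn_ofFunctor₁_weak
    h.isNonDilatingOn_ofFunctor₂_weak

/-- **Thm 4.4 (iii), saturation clause, from {`hBmon₁ / hBmon₂`, «`D_i` of FSM-type», T44-L15b}, WEAK vocabulary** for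
any `ψ` (`thm44_iii_of_thm34`). [cite: MochizukiEtTh2009, Thm 4.4 (iii) p.94] -/
theorem Thm44Hyp.thm44_iii_of_isOfFSMType_treeVocabWeak (h : Thm44Hyp S₁ S₂)
    (ψ : ∀ A : S₁.C, S₁.biratUnits A ≃* S₂.biratUnits (h.Ψ.functor.obj A))
    (hBmon₁ : IsMonoidOn S₁.tf.ratFnFunctor) (hBmon₂ : IsMonoidOn S₂.tf.ratFnFunctor)
    (hD₁ : IsOfFSMType D₁) (hD₂ : IsOfFSMType D₂) (h15 : h.PreservesNHSaturatedBsFld) :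
    Thm44_iii (V := treeMonoidVocabWeak.{w}) h ψ :=
  h.thm44_iii_of_thm34 ψ (S₁.tf.isFrobenioid_treeCatVocab_of_isMonoidOn hBmon₁)
    (S₂.tf.isFrobenioid_treeCatVocab_of_isMonoidOn hBmon₂) hD₁ hD₂ h.isNonDilatingOn_ofFunctor₁_weak
    h.isNonDilatingOn_ofFunctor₂_weak h15

end TreeVocabWeak

/-! ### §1 The canonical model instances `mkOfModelCanonical` over arbitrary bases, weak vocabulary -/

section Canonical

variable {K : Type u₀} [Field K] {K' : Type u₀} [Field K'] {X₁ : SemiGraphs.TemperedArithmeticGroup.{u₀} K}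
  {X₂ : SemiGraphs.TemperedArithmeticGroup.{u₀} K'} {D₀ : Type u₀} [Category.{v₀} D₀] {D₀' : Type u₀}
  [Category.{v₀} D₀'] {T₁ : RealifiedDivisorMonoids (D₀ := D₀) treeMonoidVocabWeak.{w}}
  {T₂ : RealifiedDivisorMonoids (D₀ := D₀') treeMonoidVocabWeak.{w}}
  {D₁ D₂ : Type u} [Category.{v} D₁] [Category.{v} D₂]
  {IsRational₁ IsStrictlyRational₁ : (D₁ᵒᵖ ⥤ CommMonCat.{w}) → Prop}
  {IsRational₂ IsStrictlyRational₂ : (D₂ᵒᵖ ⥤ CommMonCat.{w}) → Prop}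
  {tf₁ : TemperedFrobenioid T₁ D₁ (treeCatVocab D₁ IsRational₁ IsStrictlyRational₁)}
  {hZ₁ : tf₁.monoidType = MonoidType.Z} {hP₁ : ∀ A : D₁ᵒᵖ, IsPerfect (tf₁.Φ.carrier A)}
  {IG₁ : D₁ → Prop} {gS₁ : ∀ A : D₁, IG₁ A → (X₁.Pi →* Aut A)}
  {gSs₁ : ∀ (A : D₁) (hA : IG₁ A), Function.Surjective (gS₁ A hA)}
  {NH₁ : Subgroup (Field.absoluteGaloisGroup K) → tf₁.category → ℕ+ → Prop} {A₀₁ : tf₁.category}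
  {hA₀₁ : PreFrobenioid.IsFrobeniusTrivial tf₁.toElem A₀₁} {hA₀₁' : IG₁ A₀₁.base}
  {tf₂ : TemperedFrobenioid T₂ D₂ (treeCatVocab D₂ IsRational₂ IsStrictlyRational₂)}
  {hZ₂ : tf₂.monoidType = MonoidType.Z} {hP₂ : ∀ A : D₂ᵒᵖ, IsPerfect (tf₂.Φ.carrier A)}
  {IG₂ : D₂ → Prop} {gS₂ : ∀ A : D₂, IG₂ A → (X₂.Pi →* Aut A)}
  {gSs₂ : ∀ (A : D₂) (hA : IG₂ A), Function.Surjective (gS₂ A hA)}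
  {NH₂ : Subgroup (Field.absoluteGaloisGroup K') → tf₂.category → ℕ+ → Prop} {A₀₂ : tf₂.category}
  {hA₀₂ : PreFrobenioid.IsFrobeniusTrivial tf₂.toElem A₀₂} {hA₀₂' : IG₂ A₀₂.base}

/-- **T44-L04 «`Ψ` preserves base-Frobenius pairs» for the canonical model instances from {`hBmon_i`, «`D_i` of FSM-type»,
«`D_i` slim»}, WEAK vocabulary** ([FrdI] Cor 5.7 (i) over slim bases of FSM-type WITHOUT perf-factoriality,
`preservesBaseFrobeniusPairs_of_clauses`; «`C_i` of standard type» = `isOfStandardType_treeCatVocab` with the weak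
non-dilating unfolding). [cite: MochizukiEtTh2009, Thm 4.4 p.95] -/
theorem Thm44Hyp.preservesBaseFrobeniusPairs_mkOfModelCanonical_of_isOfFSMType_treeVocabWeak
    (h : Thm44Hyp (mkOfModelCanonical X₁ tf₁ hZ₁ hP₁ IG₁ gS₁ gSs₁ NH₁ A₀₁ hA₀₁ hA₀₁')
      (mkOfModelCanonical X₂ tf₂ hZ₂ hP₂ IG₂ gS₂ gSs₂ NH₂ A₀₂ hA₀₂ hA₀₂'))
    (hBmon₁ : IsMonoidOn tf₁.ratFnFunctor) (hBmon₂ : IsMonoidOn tf₂.ratFnFunctor)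
    (hD₁ : IsOfFSMType D₁) (hD₂ : IsOfFSMType D₂) (hs₁ : IsSlim D₁) (hs₂ : IsSlim D₂) :
    Thm44Hyp.PreservesBaseFrobeniusPairs (V := treeMonoidVocabWeak.{w}) h :=
  h.preservesBaseFrobeniusPairs_of_clauses (fun _ _ _ hG => hG) (fun _ _ _ hG => hG)
    (tf₁.isFrobenioid_treeCatVocab_of_isMonoidOn hBmon₁) (tf₂.isFrobenioid_treeCatVocab_of_isMonoidOn hBmon₂)
    hD₁ hD₂ hs₁ hs₂
    (tf₁.isOfStandardType_treeCatVocab hBmon₁ hD₁.isOfFSMFFType h.isNonDilatingOn_divisorMonoid₁_weak)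
    (tf₂.isOfStandardType_treeCatVocab hBmon₂ hD₂.isOfFSMFFType h.isNonDilatingOn_divisorMonoid₂_weak)

/-- **[EtTh] Thm 4.4 (ii), fraction-pair clause `Thm44_ii`, for the canonical model instances with the CONSTRUCTED
`ψ = Ψ^birat` (`psiModel`) from «`C_i` is a Frobenioid» and T44-L03 ONLY, WEAK vocabulary** (any proofs `hF₁ hF₂ h3`;
T44-L10 `biratCompatible_mkOfModel`, T44-L12 `disjointSupports_map_of_inputs`). [cite: MochizukiEtTh2009, Thm 4.4 (ii) p.94] -/
theorem thm44_ii_mkOfModelCanonical_of_isFrobenioid_treeVocabWeak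
    (h : Thm44Hyp (mkOfModelCanonical X₁ tf₁ hZ₁ hP₁ IG₁ gS₁ gSs₁ NH₁ A₀₁ hA₀₁ hA₀₁')
      (mkOfModelCanonical X₂ tf₂ hZ₂ hP₂ IG₂ gS₂ gSs₂ NH₂ A₀₂ hA₀₂ hA₀₂'))
    (hF₁ : PreFrobenioid.IsFrobenioid tf₁.toElem) (hF₂ : PreFrobenioid.IsFrobenioid tf₂.toElem)
    (h3 : h.PreservesFrobeniusStructure) : Thm44_ii (V := treeMonoidVocabWeak.{w}) h (h.psiModel hF₁ hF₂ h3) :=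
  thm44_ii_of_biratCompatible_of_preSteps h _ (h.biratCompatible_mkOfModel hF₁ hF₂ h3)
    (fun _ hs => h.isPreStep_map h3 hs)
    (fun s' s'' h' h'' hb hds => h.disjointSupports_map_of_inputs (fun _ _ hab => hab) (fun _ _ hab => hab) hF₁ hF₂
      h3 s' s'' h' h'' hb hds)

/-- **T44-L14 «`Ψ` maps `N`-th roots of fraction-pairs to `N`-th roots of fraction-pairs» for the canonical model
instances, `ψ = psiModel` (any proofs `hF₁ hF₂ h3`), pull-backs `pullFracModel`, from {`hBmon_i`, «`D_i` of FSM-type»,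
«`D_i` slim», T44-L09c, T44-L15b}, WEAK vocabulary** — NO perf-factorial binder. [cite: MochizukiEtTh2009, Thm 4.4 (ii) p.94] -/
theorem Thm44Hyp.preservesNthRoots_mkOfModelCanonical_of_isOfFSMType_treeVocabWeak
    (h : Thm44Hyp (mkOfModelCanonical X₁ tf₁ hZ₁ hP₁ IG₁ gS₁ gSs₁ NH₁ A₀₁ hA₀₁ hA₀₁')
      (mkOfModelCanonical X₂ tf₂ hZ₂ hP₂ IG₂ gS₂ gSs₂ NH₂ A₀₂ hA₀₂ hA₀₂'))
    (hF₁ : PreFrobenioid.IsFrobenioid tf₁.toElem) (hF₂ : PreFrobenioid.IsFrobenioid tf₂.toElem)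
    (h3 : h.PreservesFrobeniusStructure)
    (hBmon₁ : IsMonoidOn tf₁.ratFnFunctor) (hBmon₂ : IsMonoidOn tf₂.ratFnFunctor)
    (hD₁ : IsOfFSMType D₁) (hD₂ : IsOfFSMType D₂) (hs₁ : IsSlim D₁) (hs₂ : IsSlim D₂)
    (h9 : h.GaloisCompatible) (h15 : h.PreservesNHSaturatedBsFld) :
    Thm44Hyp.PreservesNthRoots (V := treeMonoidVocabWeak.{w}) h (h.psiModel hF₁ hF₂ h3)
      (fun φ f => tf₁.pullFracModel φ f) (fun φ f => tf₂.pullFracModel φ f) :=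
  h.preservesNthRoots_of _ (fun φ f => tf₁.pullFracModel φ f) (fun φ f => tf₂.pullFracModel φ f)
    (fun φ f => h.psiModel_pullFracModel hF₁ hF₂ h3 φ f)
    (thm44_ii_mkOfModelCanonical_of_isFrobenioid_treeVocabWeak h hF₁ hF₂ h3) h3
    (h.preservesBaseFrobeniusTypeData_of_inputs h3
      (h.preservesBaseFrobeniusPairs_mkOfModelCanonical_of_isOfFSMType_treeVocabWeak hBmon₁ hBmon₂ hD₁ hD₂ hs₁ hs₂) h9)
    (h.preservesAmple_of h9) (h.preservesFixedByHA_of _ h9 (h.biratCompatible_mkOfModel hF₁ hF₂ h3))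
    (h.preservesSaturated_of _ h3 h15)

end Canonical

/-! ### §2 At the genuine connected base `B^temp(Π^tp_X)⁰`, weak vocabulary: inputs {`hBinj₁`, `hBinj₂`} (+ T44-L15b) -/

section Connected

variable {K : Type u₀} [Field K] {K' : Type u₀} [Field K'] {X₁ : SemiGraphs.TemperedArithmeticGroup.{u₀} K}
  {X₂ : SemiGraphs.TemperedArithmeticGroup.{u₀} K'} {D₀ : Type u₀} [Category.{v₀} D₀] {D₀' : Type u₀}
  [Category.{v₀} D₀'] {T₁ : RealifiedDivisorMonoids (D₀ := D₀) treeMonoidVocabWeak.{w}}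
  {T₂ : RealifiedDivisorMonoids (D₀ := D₀') treeMonoidVocabWeak.{w}}
  {IsRational₁ IsStrictlyRational₁ : ((ConnectedPart (BTemp X₁.Pi))ᵒᵖ ⥤ CommMonCat.{w}) → Prop}
  {IsRational₂ IsStrictlyRational₂ : ((ConnectedPart (BTemp X₂.Pi))ᵒᵖ ⥤ CommMonCat.{w}) → Prop}
  {tf₁ : TemperedFrobenioid T₁ (ConnectedPart (BTemp X₁.Pi))
    (treeCatVocab (ConnectedPart (BTemp X₁.Pi)) IsRational₁ IsStrictlyRational₁)}
  {hZ₁ : tf₁.monoidType = MonoidType.Z} {hP₁ : ∀ A : (ConnectedPart (BTemp X₁.Pi))ᵒᵖ, IsPerfect (tf₁.Φ.carrier A)}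
  {NH₁ : Subgroup (Field.absoluteGaloisGroup K) → tf₁.category → ℕ+ → Prop} {A₁ : tf₁.category}
  {hA₁ : PreFrobenioid.IsFrobeniusTrivial tf₁.toElem A₁} {hA₁' : SemiGraphs.IsGaloisObj A₁.base.obj}
  {tf₂ : TemperedFrobenioid T₂ (ConnectedPart (BTemp X₂.Pi))
    (treeCatVocab (ConnectedPart (BTemp X₂.Pi)) IsRational₂ IsStrictlyRational₂)}
  {hZ₂ : tf₂.monoidType = MonoidType.Z} {hP₂ : ∀ B : (ConnectedPart (BTemp X₂.Pi))ᵒᵖ, IsPerfect (tf₂.Φ.carrier B)}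
  {NH₂ : Subgroup (Field.absoluteGaloisGroup K') → tf₂.category → ℕ+ → Prop} {A₂ : tf₂.category}
  {hA₂ : PreFrobenioid.IsFrobeniusTrivial tf₂.toElem A₂} {hA₂' : SemiGraphs.IsGaloisObj A₂.base.obj}

/-- **T44-L03 at the genuine connected base from `hBinj₁ / hBinj₂` ALONE, WEAK vocabulary.** [cite: MochizukiEtTh2009, Thm 4.4 p.95] -/
theorem Thm44Hyp.preservesFrobeniusStructure_mkOfConnectedTemperoid_of_hBinj_treeVocabWeak
    (h : Thm44Hyp (mkOfConnectedTemperoid X₁ tf₁ hZ₁ hP₁ NH₁ A₁ hA₁ hA₁')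
      (mkOfConnectedTemperoid X₂ tf₂ hZ₂ hP₂ NH₂ A₂ hA₂ hA₂'))
    (hBinj₁ : ∀ {Y Y' : D₀ᵒᵖ} (g : Y ⟶ Y'), Injective (T₁.BΛ.map g).hom)
    (hBinj₂ : ∀ {Y Y' : D₀'ᵒᵖ} (g : Y ⟶ Y'), Injective (T₂.BΛ.map g).hom) :
    Thm44Hyp.PreservesFrobeniusStructure (V := treeMonoidVocabWeak.{w}) h :=
  h.preservesFrobeniusStructure_of_isOfFSMType_treeVocabWeak (tf₁.isMonoidOn_ratFnFunctor hBinj₁ fun α hα =>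
      (QuasiTemperoid.BTempConnected.connectedPart_isOfFSMType (G := X₁.Pi)).isIso_of_isFSM α hα)
    (tf₂.isMonoidOn_ratFnFunctor hBinj₂ fun α hα =>
      (QuasiTemperoid.BTempConnected.connectedPart_isOfFSMType (G := X₂.Pi)).isIso_of_isFSM α hα)
    QuasiTemperoid.BTempConnected.connectedPart_isOfFSMType QuasiTemperoid.BTempConnected.connectedPart_isOfFSMType

/-- **Thm 4.4 (i) at the genuine connected base from `hBinj₁ / hBinj₂` ALONE, WEAK vocabulary**: abc-iut-w5-d013's
`thm44_i_mkOfConnectedTemperoid` (T44-L09 / T44-L09c / T44-L08 unconditional over `B^temp(Π^tp_X)⁰`) with its two inputs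
«`C₂` is a Frobenioid» and T44-L03 supplied from `hBinj`. [cite: MochizukiEtTh2009, Thm 4.4 (i) p.94] -/
theorem Thm44Hyp.thm44_i_mkOfConnectedTemperoid_of_hBinj_treeVocabWeak
    (h : Thm44Hyp (mkOfConnectedTemperoid X₁ tf₁ hZ₁ hP₁ NH₁ A₁ hA₁ hA₁')
      (mkOfConnectedTemperoid X₂ tf₂ hZ₂ hP₂ NH₂ A₂ hA₂ hA₂'))
    (hBinj₁ : ∀ {Y Y' : D₀ᵒᵖ} (g : Y ⟶ Y'), Injective (T₁.BΛ.map g).hom)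
    (hBinj₂ : ∀ {Y Y' : D₀'ᵒᵖ} (g : Y ⟶ Y'), Injective (T₂.BΛ.map g).hom) :
    Thm44_i (V := treeMonoidVocabWeak.{w}) h :=
  h.thm44_i_mkOfConnectedTemperoid _ _ _ _ _ _ _ _ _ _ _ _ _ _ (tf₂.isFrobenioid_of_structural hBinj₂ fun α hα =>
        (QuasiTemperoid.BTempConnected.connectedPart_isOfFSMType (G := X₂.Pi)).isIso_of_isFSM α hα)
    (h.preservesFrobeniusStructure_mkOfConnectedTemperoid_of_hBinj_treeVocabWeak hBinj₁ hBinj₂)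

/-- **Thm 4.4 (ii), fraction-pair clause, at the genuine connected base, WEAK vocabulary** for `ψ = psiModel hF₁ hF₂ h3`
over ANY proofs — NO further input. [cite: MochizukiEtTh2009, Thm 4.4 (ii) p.94] -/
theorem Thm44Hyp.thm44_ii_mkOfConnectedTemperoid_of_isFrobenioid_treeVocabWeak
    (h : Thm44Hyp (mkOfConnectedTemperoid X₁ tf₁ hZ₁ hP₁ NH₁ A₁ hA₁ hA₁')
      (mkOfConnectedTemperoid X₂ tf₂ hZ₂ hP₂ NH₂ A₂ hA₂ hA₂'))
    (hF₁ : PreFrobenioid.IsFrobenioid tf₁.toElem) (hF₂ : PreFrobenioid.IsFrobenioid tf₂.toElem)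
    (h3 : h.PreservesFrobeniusStructure) : Thm44_ii (V := treeMonoidVocabWeak.{w}) h (h.psiModel hF₁ hF₂ h3) :=
  thm44_ii_mkOfModelCanonical_of_isFrobenioid_treeVocabWeak h hF₁ hF₂ h3

/-- **Thm 4.4 (iii), saturation clause, at the genuine connected base from {`hBinj₁ / hBinj₂`, T44-L15b}, WEAK
vocabulary** for `ψ = psiModel hF₁ hF₂ h3` (any proofs). [cite: MochizukiEtTh2009, Thm 4.4 (iii) p.94] -/
theorem Thm44Hyp.thm44_iii_mkOfConnectedTemperoid_of_hBinj_treeVocabWeak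
    (h : Thm44Hyp (mkOfConnectedTemperoid X₁ tf₁ hZ₁ hP₁ NH₁ A₁ hA₁ hA₁')
      (mkOfConnectedTemperoid X₂ tf₂ hZ₂ hP₂ NH₂ A₂ hA₂ hA₂'))
    (hF₁ : PreFrobenioid.IsFrobenioid tf₁.toElem) (hF₂ : PreFrobenioid.IsFrobenioid tf₂.toElem)
    (h3 : h.PreservesFrobeniusStructure)
    (hBinj₁ : ∀ {Y Y' : D₀ᵒᵖ} (g : Y ⟶ Y'), Injective (T₁.BΛ.map g).hom)
    (hBinj₂ : ∀ {Y Y' : D₀'ᵒᵖ} (g : Y ⟶ Y'), Injective (T₂.BΛ.map g).hom) (h15 : h.PreservesNHSaturatedBsFld) :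
    Thm44_iii (V := treeMonoidVocabWeak.{w}) h (h.psiModel hF₁ hF₂ h3) :=
  h.thm44_iii_of_isOfFSMType_treeVocabWeak _ (tf₁.isMonoidOn_ratFnFunctor hBinj₁ fun α hα =>
      (QuasiTemperoid.BTempConnected.connectedPart_isOfFSMType (G := X₁.Pi)).isIso_of_isFSM α hα)
    (tf₂.isMonoidOn_ratFnFunctor hBinj₂ fun α hα =>
      (QuasiTemperoid.BTempConnected.connectedPart_isOfFSMType (G := X₂.Pi)).isIso_of_isFSM α hα)
    QuasiTemperoid.BTempConnected.connectedPart_isOfFSMType QuasiTemperoid.BTempConnected.connectedPart_isOfFSMType h15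

/-- **Thm 4.4 (ii), `N`-th-roots clause (T44-L14), at the genuine connected base from {`hBinj₁ / hBinj₂`, T44-L15b}, WEAK
vocabulary**: `ψ = psiModel hF₁ hF₂ h3` (any proofs), pull-backs `pullFracModel`; «`D_i` slim» is [SemiAnbd] Rmk 3.4.1 /
Ex 3.10, «`D_i` of FSM-type» is [FrdII] Ex 1.3 (i), T44-L09c is abc-iut-w5-d013's `galoisCompatible_mkOfConnectedTemperoid`.
[cite: MochizukiEtTh2009, Thm 4.4 (ii) p.94] -/
theorem Thm44Hyp.preservesNthRoots_mkOfConnectedTemperoid_of_hBinj_treeVocabWeak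
    (h : Thm44Hyp (mkOfConnectedTemperoid X₁ tf₁ hZ₁ hP₁ NH₁ A₁ hA₁ hA₁')
      (mkOfConnectedTemperoid X₂ tf₂ hZ₂ hP₂ NH₂ A₂ hA₂ hA₂'))
    (hF₁ : PreFrobenioid.IsFrobenioid tf₁.toElem) (hF₂ : PreFrobenioid.IsFrobenioid tf₂.toElem)
    (h3 : h.PreservesFrobeniusStructure)
    (hBinj₁ : ∀ {Y Y' : D₀ᵒᵖ} (g : Y ⟶ Y'), Injective (T₁.BΛ.map g).hom)
    (hBinj₂ : ∀ {Y Y' : D₀'ᵒᵖ} (g : Y ⟶ Y'), Injective (T₂.BΛ.map g).hom) (h15 : h.PreservesNHSaturatedBsFld) :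
    Thm44Hyp.PreservesNthRoots (V := treeMonoidVocabWeak.{w}) h (h.psiModel hF₁ hF₂ h3)
      (fun φ f => tf₁.pullFracModel φ f) (fun φ f => tf₂.pullFracModel φ f) :=
  h.preservesNthRoots_mkOfModelCanonical_of_isOfFSMType_treeVocabWeak hF₁ hF₂ h3
    (tf₁.isMonoidOn_ratFnFunctor hBinj₁ fun α hα =>
      (QuasiTemperoid.BTempConnected.connectedPart_isOfFSMType (G := X₁.Pi)).isIso_of_isFSM α hα)
    (tf₂.isMonoidOn_ratFnFunctor hBinj₂ fun α hα =>
      (QuasiTemperoid.BTempConnected.connectedPart_isOfFSMType (G := X₂.Pi)).isIso_of_isFSM α hα)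
    QuasiTemperoid.BTempConnected.connectedPart_isOfFSMType QuasiTemperoid.BTempConnected.connectedPart_isOfFSMType
    X₁.isSlim_connectedPart X₂.isSlim_connectedPart
    (h.galoisCompatible_mkOfConnectedTemperoid _ _ _ _ _ _ _ _ _ _ _ _ _ _) h15

/-- **[EtTh] Theorem 4.4 at the genuine connected base `B^temp(Π^tp_X)⁰` over the WEAK vocabulary, binder census
{Rmk 3.7.2, `hBmon`} ↦ {`hBinj`}**: (i) ∧ (ii) (fraction-pairs) ∧ (iii) (saturation) ∧ (ii) (`N`-th roots), for the
settings `mkOfConnectedTemperoid` over realified data typed with `treeMonoidVocabWeak`, the CONSTRUCTED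
`ψ = Ψ^birat = psiModel hF₁ hF₂ h3` (any proofs) and the model pull-backs — modulo ONLY {`hBinj₁ / hBinj₂` (pull-backs of
the Def 3.6 (i) datum `B₀^Λ` injective, Def 3.3 (iii)), T44-L15b ([FrdII] Def 2.2 (ii))}: the weak-vocabulary twin of
abc-iut-w5-d179's `thm44_mkOfConnectedTemperoid_of_hBinj`; no named fact of plan/FACT-LIST and no perf-factorial binder
is an input. [cite: MochizukiEtTh2009, Thm 4.4 p.94] -/
theorem Thm44Hyp.thm44_mkOfConnectedTemperoid_of_hBinj_treeVocabWeak
    (h : Thm44Hyp (mkOfConnectedTemperoid X₁ tf₁ hZ₁ hP₁ NH₁ A₁ hA₁ hA₁')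
      (mkOfConnectedTemperoid X₂ tf₂ hZ₂ hP₂ NH₂ A₂ hA₂ hA₂'))
    (hF₁ : PreFrobenioid.IsFrobenioid tf₁.toElem) (hF₂ : PreFrobenioid.IsFrobenioid tf₂.toElem)
    (h3 : h.PreservesFrobeniusStructure)
    (hBinj₁ : ∀ {Y Y' : D₀ᵒᵖ} (g : Y ⟶ Y'), Injective (T₁.BΛ.map g).hom)
    (hBinj₂ : ∀ {Y Y' : D₀'ᵒᵖ} (g : Y ⟶ Y'), Injective (T₂.BΛ.map g).hom) (h15 : h.PreservesNHSaturatedBsFld) :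
    Thm44_i (V := treeMonoidVocabWeak.{w}) h ∧ Thm44_ii h (h.psiModel hF₁ hF₂ h3) ∧ Thm44_iii h (h.psiModel hF₁ hF₂ h3) ∧
      h.PreservesNthRoots (h.psiModel hF₁ hF₂ h3) (fun φ f => tf₁.pullFracModel φ f)
        (fun φ f => tf₂.pullFracModel φ f) :=
  ⟨h.thm44_i_mkOfConnectedTemperoid_of_hBinj_treeVocabWeak hBinj₁ hBinj₂,
    h.thm44_ii_mkOfConnectedTemperoid_of_isFrobenioid_treeVocabWeak hF₁ hF₂ h3,
    h.thm44_iii_mkOfConnectedTemperoid_of_hBinj_treeVocabWeak hF₁ hF₂ h3 hBinj₁ hBinj₂ h15,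
    h.preservesNthRoots_mkOfConnectedTemperoid_of_hBinj_treeVocabWeak hF₁ hF₂ h3 hBinj₁ hBinj₂ h15⟩

/-- **The same with the ψ-slot proofs themselves supplied from `hBinj`** — literally ⇐ {`hBinj₁`, `hBinj₂`, T44-L15b}, WEAK
vocabulary. [cite: MochizukiEtTh2009, Thm 4.4 p.94] -/
theorem Thm44Hyp.thm44_mkOfConnectedTemperoid_of_hBinj_treeVocabWeak'
    (h : Thm44Hyp (mkOfConnectedTemperoid X₁ tf₁ hZ₁ hP₁ NH₁ A₁ hA₁ hA₁')
      (mkOfConnectedTemperoid X₂ tf₂ hZ₂ hP₂ NH₂ A₂ hA₂ hA₂'))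
    (hBinj₁ : ∀ {Y Y' : D₀ᵒᵖ} (g : Y ⟶ Y'), Injective (T₁.BΛ.map g).hom)
    (hBinj₂ : ∀ {Y Y' : D₀'ᵒᵖ} (g : Y ⟶ Y'), Injective (T₂.BΛ.map g).hom) (h15 : h.PreservesNHSaturatedBsFld) :
    Thm44_i (V := treeMonoidVocabWeak.{w}) h ∧
      Thm44_ii h (h.psiModel (tf₁.isFrobenioid_of_structural hBinj₁ fun α hα =>
        (QuasiTemperoid.BTempConnected.connectedPart_isOfFSMType (G := X₁.Pi)).isIso_of_isFSM α hα)
        (tf₂.isFrobenioid_of_structural hBinj₂ fun α hα =>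
        (QuasiTemperoid.BTempConnected.connectedPart_isOfFSMType (G := X₂.Pi)).isIso_of_isFSM α hα)
        (h.preservesFrobeniusStructure_mkOfConnectedTemperoid_of_hBinj_treeVocabWeak hBinj₁ hBinj₂)) ∧
      Thm44_iii h (h.psiModel (tf₁.isFrobenioid_of_structural hBinj₁ fun α hα =>
        (QuasiTemperoid.BTempConnected.connectedPart_isOfFSMType (G := X₁.Pi)).isIso_of_isFSM α hα)
        (tf₂.isFrobenioid_of_structural hBinj₂ fun α hα =>
        (QuasiTemperoid.BTempConnected.connectedPart_isOfFSMType (G := X₂.Pi)).isIso_of_isFSM α hα)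
        (h.preservesFrobeniusStructure_mkOfConnectedTemperoid_of_hBinj_treeVocabWeak hBinj₁ hBinj₂)) ∧
      h.PreservesNthRoots (h.psiModel (tf₁.isFrobenioid_of_structural hBinj₁ fun α hα =>
        (QuasiTemperoid.BTempConnected.connectedPart_isOfFSMType (G := X₁.Pi)).isIso_of_isFSM α hα)
        (tf₂.isFrobenioid_of_structural hBinj₂ fun α hα =>
        (QuasiTemperoid.BTempConnected.connectedPart_isOfFSMType (G := X₂.Pi)).isIso_of_isFSM α hα)
        (h.preservesFrobeniusStructure_mkOfConnectedTemperoid_of_hBinj_treeVocabWeak hBinj₁ hBinj₂))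
        (fun φ f => tf₁.pullFracModel φ f) (fun φ f => tf₂.pullFracModel φ f) :=
  h.thm44_mkOfConnectedTemperoid_of_hBinj_treeVocabWeak _ _ _ hBinj₁ hBinj₂ h15

end Connected

/-! ### §3 At the genuine connected base with `NH :=` the ROOTS READING: inputs {`hBinj₁`, `hBinj₂`} ONLY -/

section ConnectedRoots

variable {K : Type u₀} [Field K] {K' : Type u₀} [Field K'] {X₁ : SemiGraphs.TemperedArithmeticGroup.{u₀} K}
  {X₂ : SemiGraphs.TemperedArithmeticGroup.{u₀} K'} {D₀ : Type u₀} [Category.{v₀} D₀] {D₀' : Type u₀}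
  [Category.{v₀} D₀'] {T₁ : RealifiedDivisorMonoids (D₀ := D₀) treeMonoidVocabWeak.{w}}
  {T₂ : RealifiedDivisorMonoids (D₀ := D₀') treeMonoidVocabWeak.{w}}
  {IsRational₁ IsStrictlyRational₁ : ((ConnectedPart (BTemp X₁.Pi))ᵒᵖ ⥤ CommMonCat.{w}) → Prop}
  {IsRational₂ IsStrictlyRational₂ : ((ConnectedPart (BTemp X₂.Pi))ᵒᵖ ⥤ CommMonCat.{w}) → Prop}
  {tf₁ : TemperedFrobenioid T₁ (ConnectedPart (BTemp X₁.Pi))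
    (treeCatVocab (ConnectedPart (BTemp X₁.Pi)) IsRational₁ IsStrictlyRational₁)}
  {hZ₁ : tf₁.monoidType = MonoidType.Z} {hP₁ : ∀ A : (ConnectedPart (BTemp X₁.Pi))ᵒᵖ, IsPerfect (tf₁.Φ.carrier A)}
  {A₁ : tf₁.category} {hA₁ : PreFrobenioid.IsFrobeniusTrivial tf₁.toElem A₁}
  {hA₁' : SemiGraphs.IsGaloisObj A₁.base.obj}
  {tf₂ : TemperedFrobenioid T₂ (ConnectedPart (BTemp X₂.Pi))
    (treeCatVocab (ConnectedPart (BTemp X₂.Pi)) IsRational₂ IsStrictlyRational₂)}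
  {hZ₂ : tf₂.monoidType = MonoidType.Z} {hP₂ : ∀ B : (ConnectedPart (BTemp X₂.Pi))ᵒᵖ, IsPerfect (tf₂.Φ.carrier B)}
  {A₂ : tf₂.category} {hA₂ : PreFrobenioid.IsFrobeniusTrivial tf₂.toElem A₂}
  {hA₂' : SemiGraphs.IsGaloisObj A₂.base.obj}

/-- **[EtTh] Theorem 4.4 (i) ∧ (ii) ∧ (iii) ∧ (`N`-th roots) at the genuine connected base `B^temp(Π^tp_X)⁰` over the WEAK
vocabulary AT THE ROOTS READING of the `(N, H_⊙^{bs-fld})`-saturation slot ⇐ {`hBinj₁`, `hBinj₂`} ONLY** (ψ-slot proofs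
from `hBinj`; T44-L15b at the reading is abc-iut-w4-d044's `preservesNHSaturatedBsFld_rootsReading`; HONEST LABEL: the
roots reading is weaker than print's cohomological [FrdII] Def 2.2 (ii)(c)) — no named fact of plan/FACT-LIST, no
perf-factorial binder, no Def 3.6 (ii) `hBmon` datum: only the injectivity of the pull-backs of the INPUT datum `B₀^Λ`
(Def 3.3 (iii)). [cite: MochizukiEtTh2009, Thm 4.4 p.94] -/
theorem Thm44Hyp.thm44_mkOfConnectedTemperoid_rootsReading_of_hBinj_treeVocabWeak
    (h : Thm44Hyp
      (mkOfConnectedTemperoid X₁ tf₁ hZ₁ hP₁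
        (fun _ A M => ∀ (g : A.base ⟶ A₁.base) (x : tf₁.ratFnFunctor.obj (op A₁.base)),
          divB tf₁.divisorMonoid tf₁.ratFnFunctor tf₁.divBNatTrans (op A₁.base) x = 1 →
            ∃ ζ : tf₁.ratFnFunctor.obj (op A.base), ζ ^ (M : ℕ) = pull tf₁.ratFnFunctor g x)
        A₁ hA₁ hA₁')
      (mkOfConnectedTemperoid X₂ tf₂ hZ₂ hP₂
        (fun _ A M => ∀ (g : A.base ⟶ A₂.base) (x : tf₂.ratFnFunctor.obj (op A₂.base)),
          divB tf₂.divisorMonoid tf₂.ratFnFunctor tf₂.divBNatTrans (op A₂.base) x = 1 →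
            ∃ ζ : tf₂.ratFnFunctor.obj (op A.base), ζ ^ (M : ℕ) = pull tf₂.ratFnFunctor g x)
        A₂ hA₂ hA₂'))
    (hBinj₁ : ∀ {Y Y' : D₀ᵒᵖ} (g : Y ⟶ Y'), Injective (T₁.BΛ.map g).hom)
    (hBinj₂ : ∀ {Y Y' : D₀'ᵒᵖ} (g : Y ⟶ Y'), Injective (T₂.BΛ.map g).hom) :
    Thm44_i (V := treeMonoidVocabWeak.{w}) h ∧
      Thm44_ii h (h.psiModel (tf₁.isFrobenioid_of_structural hBinj₁ fun α hα =>
        (QuasiTemperoid.BTempConnected.connectedPart_isOfFSMType (G := X₁.Pi)).isIso_of_isFSM α hα)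
        (tf₂.isFrobenioid_of_structural hBinj₂ fun α hα =>
        (QuasiTemperoid.BTempConnected.connectedPart_isOfFSMType (G := X₂.Pi)).isIso_of_isFSM α hα)
        (h.preservesFrobeniusStructure_mkOfConnectedTemperoid_of_hBinj_treeVocabWeak hBinj₁ hBinj₂)) ∧
      Thm44_iii h (h.psiModel (tf₁.isFrobenioid_of_structural hBinj₁ fun α hα =>
        (QuasiTemperoid.BTempConnected.connectedPart_isOfFSMType (G := X₁.Pi)).isIso_of_isFSM α hα)
        (tf₂.isFrobenioid_of_structural hBinj₂ fun α hα =>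
        (QuasiTemperoid.BTempConnected.connectedPart_isOfFSMType (G := X₂.Pi)).isIso_of_isFSM α hα)
        (h.preservesFrobeniusStructure_mkOfConnectedTemperoid_of_hBinj_treeVocabWeak hBinj₁ hBinj₂)) ∧
      h.PreservesNthRoots (h.psiModel (tf₁.isFrobenioid_of_structural hBinj₁ fun α hα =>
        (QuasiTemperoid.BTempConnected.connectedPart_isOfFSMType (G := X₁.Pi)).isIso_of_isFSM α hα)
        (tf₂.isFrobenioid_of_structural hBinj₂ fun α hα =>
        (QuasiTemperoid.BTempConnected.connectedPart_isOfFSMType (G := X₂.Pi)).isIso_of_isFSM α hα)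
        (h.preservesFrobeniusStructure_mkOfConnectedTemperoid_of_hBinj_treeVocabWeak hBinj₁ hBinj₂))
        (fun φ f => tf₁.pullFracModel φ f) (fun φ f => tf₂.pullFracModel φ f) :=
  h.thm44_mkOfConnectedTemperoid_of_hBinj_treeVocabWeak' hBinj₁ hBinj₂
    (Thm44Hyp.preservesNHSaturatedBsFld_rootsReading tf₁ hZ₁ hP₁ _ _ _ A₁ hA₁ hA₁' tf₂ hZ₂ hP₂ _ _ _ A₂ hA₂ hA₂' h
      (tf₁.isFrobenioid_of_structural hBinj₁ fun α hα =>
        (QuasiTemperoid.BTempConnected.connectedPart_isOfFSMType (G := X₁.Pi)).isIso_of_isFSM α hα)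
      (tf₂.isFrobenioid_of_structural hBinj₂ fun α hα =>
        (QuasiTemperoid.BTempConnected.connectedPart_isOfFSMType (G := X₂.Pi)).isIso_of_isFSM α hα)
      (h.preservesFrobeniusStructure_mkOfConnectedTemperoid_of_hBinj_treeVocabWeak hBinj₁ hBinj₂))

end ConnectedRoots

end BiKummerSetting

end Literature.AnabelianGeometry.EtaleTheta

end
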